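import Summits.CriticalPhenomena.PercolationContinuityZ3.Theorems.PercNearOneGluingNoHeavyLowerTailSunflowerBottomSlack
import Summits.CriticalPhenomena.PercolationContinuityZ3.Theorems.PercNearOneGluingNoHeavyLowerTailSunflowerPartitionReduction
import HarnessLib
import HarnessLib.Audit

/-!
# `NoHeavyLowerTail` (crux stmt-CriticalPhenomena-4575), abstract sunflower cubic: DELETION–CONTRACTION SUPERADDITIVITY of the bottom slack
# — the typed conjecture `MinorSuperadditivity` (DC) and the induction `MinorSuperadditivity → BottomSlackPaysRainbows → PartitionLemmaH`

Support file (seat `prim-l12-p2` gen 20; `--supports stmt-CriticalPhenomena-4575`).  No `sorry`.  Definitions: `Sunflower.minorAB`,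
`Sunflower.minorCR`, `Sunflower.minorRainbows`, `Sunflower.minorSlack` (the bottom slack `f(W;C)` of the MINOR `(W;C)` of a sunflower:
ground set `W`, labels `X ↦ lab (X ∪ C)` — deletion of `univ ∖ (W ∪ C)`, contraction of `C`) and the `@[conjecture]` `MinorSuperadditivity`
(an obligation of this programme — census-true, unproved —, never a fact).
Memo: run/shared/lean/prim/prim-l12/prim-l12-p2/FINDING-g20-COMPLEMENT-READING.md §8.

`f(W;C) := Σ_{S ⊆ W, lab(S∪C)=0} ( #AB − #CR )(cube W∖S, labels ·∪C) − #{rainbow partitions of W for the labels ·∪C}`  (so `f(univ;∅)` is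
`Σ_{lab S = 0} cubeSlack Sᶜ − #rainbows`, the quantity of (★_B), `minorSlack_univ_empty`).

* `MinorSuperadditivity` (DC, typed conjecture, NEW):  for `x ∈ W`:   `f(W;C) ≥ f(W∖x; C) + f(W∖x; C ∪ {x})`   (deletion + contraction of `x`).
  CENSUS (gen 20): n = 3, 4, 5 EXHAUSTIVE — every monotone map `2^n → M₃` and every element `x` (n = 5: 275 665 902 maps × 5, 0 failures,
  8 265 320 equalities) —, n = 6, 7 sampled (14 000 (map, x) pairs over four generators incl. all-petals-non-intersecting): 0 failures.
  The analogous superadditivity FAILS for the kernel-spectator slack and for `ZH/6` itself (16–30 % of (map, x) pairs) — (★_B), not ★, is the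
  inductive quantity; the second-order version (in `y` after `x`) also fails.  Anatomy (memo §8): at an element `x` with `lab {x} = 4` the
  step is trivial, at a FREE element (`lab (T ∪ {x}) = lab T` for all `T`) it is exactly (★_B) for the deletion — so (DC) organises, but does
  not by itself localise, a proof of ★; the per-cube part `gl_F(U'+x) ≥ gl_{F∖x}(U') + gl_{F/x}(U')` is an elementary injection (memo §8(c)).
* `Sunflower.minorSlack_empty` : `f(∅;C) = 0`;  `Sunflower.minorSlack_nonneg_of_minorSuperadditivity` : (DC) ⇒ `f(W;C) ≥ 0` for all
  disjoint `W, C` (induction on `#W`);  `Sunflower.minorSlack_univ_empty` : `f(univ;∅) = Σ_{lab S=0} cubeSlack Sᶜ − rainbowCard`;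
  `bottomSlackPaysRainbows_of_minorSuperadditivity` and `partitionLemmaH_of_minorSuperadditivity` : **(DC) ⇒ (★_B) ⇒ ★**.
-/

namespace Summit.CriticalPhenomena.PercolationContinuityZ3.Theorems.SunflowerPartition

open Finset

namespace Sunflower

variable {α : Type*} [Fintype α] [DecidableEq α] (F : Sunflower α)

/-! ## The bottom slack of a minor `(W;C)` -/

/-- `#AB` of the cube `U` in the minor with contracted set `C`: bottom sets `O ⊆ U` (`lab (O ∪ C) = 0`) with kernel complement
(`lab ((U ∖ O) ∪ C) = 4`). [this work] -/
def minorAB (C U : Finset α) : ℕ := (U.powerset.filter (fun O => F.lab (O ∪ C) = 0 ∧ F.lab ((U \ O) ∪ C) = 4)).card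

/-- `#CR` of the cube `U` in the minor with contracted set `C`: cross pairs listed by the larger-label side `Y`. [this work] -/
def minorCR (C U : Finset α) : ℕ :=
  (U.powerset.filter (fun Y => F.lab (Y ∪ C) ≠ 0 ∧ F.lab (Y ∪ C) ≠ 4 ∧ F.lab ((U \ Y) ∪ C) ≠ 0 ∧ F.lab ((U \ Y) ∪ C) ≠ 4 ∧
    F.lab ((U \ Y) ∪ C) < F.lab (Y ∪ C))).card

/-- The rainbows of the minor `(W;C)`: ordered 3-partitions `(P,Q,W∖(P∪Q))` of `W` with labels `(1,2,3)` after adjoining `C`. [this work] -/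
def minorRainbows (W C : Finset α) : ℕ :=
  ((partsOf W).filter (fun q => F.lab (q.1 ∪ C) = 1 ∧ F.lab (q.2 ∪ C) = 2 ∧ F.lab ((W \ (q.1 ∪ q.2)) ∪ C) = 3)).card

/-- **The bottom slack `f(W;C)` of the minor `(W;C)`**: the Gladkov slacks of its bottom-spectator cubes minus its rainbows. [this work] -/
def minorSlack (W C : Finset α) : ℤ :=
  (∑ S ∈ W.powerset.filter (fun S => F.lab (S ∪ C) = 0), ((F.minorAB C (W \ S) : ℤ) - (F.minorCR C (W \ S) : ℤ)))
    - (F.minorRainbows W C : ℤ)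

/-! ## The typed conjecture (DC) -/

/-- **(DC) DELETION–CONTRACTION SUPERADDITIVITY OF THE BOTTOM SLACK** (this work; OPEN, census-clean — file header): for every sunflower,
every minor `(W;C)` (`W, C` disjoint) and every `x ∈ W`, `f(W∖x; C) + f(W∖x; C ∪ {x}) ≤ f(W; C)`.  An obligation, never a fact: use as
`(h : MinorSuperadditivity)`. [status: open] -/
@[conjecture] def _root_.Summit.CriticalPhenomena.PercolationContinuityZ3.Theorems.SunflowerPartition.MinorSuperadditivity : Prop :=
  ∀ (α : Type) [Fintype α] [DecidableEq α] (F : Sunflower α) (W C : Finset α) (x : α), x ∈ W → Disjoint W C →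
    F.minorSlack (W.erase x) C + F.minorSlack (W.erase x) (insert x C) ≤ F.minorSlack W C

/-! ## The induction -/

omit [Fintype α] in
/-- `f(∅;C) = 0`: the empty ground set has neither slack nor rainbows. [this work] -/
theorem minorSlack_empty (C : Finset α) : F.minorSlack ∅ C = 0 := by
  unfold minorSlack
  have hR : F.minorRainbows ∅ C = 0 := by
    unfold minorRainbows
    rw [partsOf_empty, Finset.card_eq_zero, Finset.filter_eq_empty_iff]
    intro q hq h
    rw [mem_singleton] at hq
    subst hq
    simp only [empty_union, union_idempotent, sdiff_empty] at h
    rw [h.1] at h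
    exact absurd h.2.1 (by decide)
  rw [hR]
  have hS : ∀ S ∈ (∅ : Finset α).powerset.filter (fun S => F.lab (S ∪ C) = 0),
      ((F.minorAB C (∅ \ S) : ℤ) - (F.minorCR C (∅ \ S) : ℤ)) = 0 := by
    intro S hS
    obtain ⟨hS0, hC0⟩ := mem_filter.1 hS
    rw [powerset_empty, mem_singleton] at hS0
    subst hS0
    rw [empty_union] at hC0
    have hAB : F.minorAB C (∅ \ ∅) = 0 := by
      unfold minorAB
      rw [Finset.card_eq_zero, Finset.filter_eq_empty_iff]
      intro O hO h
      rw [Finset.sdiff_self, powerset_empty, mem_singleton] at hO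
      subst hO
      simp only [Finset.sdiff_self, empty_union] at h
      rw [hC0] at h
      exact absurd h.2 (by decide)
    have hCR : F.minorCR C (∅ \ ∅) = 0 := by
      unfold minorCR
      rw [Finset.card_eq_zero, Finset.filter_eq_empty_iff]
      intro Y hY h
      rw [Finset.sdiff_self, powerset_empty, mem_singleton] at hY
      subst hY
      simp only [Finset.sdiff_self, empty_union] at h
      exact absurd h.2.2.2.2 (lt_irrefl _)
    rw [hAB, hCR]; simp
  rw [Finset.sum_eq_zero hS]; simp

/-- **(DC) ⇒ `f(W;C) ≥ 0`** for every minor (induction on `#W`: delete and contract an element). [this work] -/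
theorem minorSlack_nonneg_of_minorSuperadditivity {α : Type} [Fintype α] [DecidableEq α] (F : Sunflower α)
    (h : MinorSuperadditivity) : ∀ (W C : Finset α), Disjoint W C → 0 ≤ F.minorSlack W C := by
  intro W
  induction W using Finset.strongInduction with
  | H W ih =>
    intro C hWC
    rcases W.eq_empty_or_nonempty with hW | ⟨x, hx⟩
    · subst hW; rw [F.minorSlack_empty]
    · have h1 : 0 ≤ F.minorSlack (W.erase x) C :=
        ih (W.erase x) (Finset.erase_ssubset hx) C (Finset.disjoint_of_subset_left (Finset.erase_subset x W) hWC)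
      have h2 : 0 ≤ F.minorSlack (W.erase x) (insert x C) := by
        refine ih (W.erase x) (Finset.erase_ssubset hx) (insert x C) ?_
        rw [Finset.disjoint_insert_right]
        exact ⟨Finset.notMem_erase x W, Finset.disjoint_of_subset_left (Finset.erase_subset x W) hWC⟩
      have h3 := h α F W C x hx hWC
      linarith

/-! ## The top minor `(univ;∅)` is the bottom slack of (★_B) -/

omit [Fintype α] in
/-- `#AB` of the top minor is `abCard`. [this work] -/
theorem minorAB_empty (U : Finset α) : F.minorAB ∅ U = F.abCard U := by
  unfold minorAB abCard
  simp only [union_empty]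

omit [Fintype α] in
/-- `#CR` of the top minor is `crCard`. [this work] -/
theorem minorCR_empty (U : Finset α) : F.minorCR ∅ U = F.crCard U := by
  unfold minorCR crCard
  simp only [union_empty]

/-- The rainbows of the top minor are the rainbows. [this work] -/
theorem minorRainbows_univ_empty : F.minorRainbows univ ∅ = F.rainbowCard := by
  unfold minorRainbows rainbowCard
  rw [partsOf_univ]
  congr 1
  ext q
  simp only [mem_filter, union_empty, ← Finset.compl_eq_univ_sdiff]
  unfold Sunflower.dem IsRainbow
  rw [mem_filter]
  constructor
  · rintro ⟨hp, h1, h2, h3⟩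
    refine ⟨⟨hp, ?_⟩, h1, h2, h3⟩
    unfold demInd; rw [h1, h2, h3]; decide
  · rintro ⟨⟨hp, -⟩, h1, h2, h3⟩
    exact ⟨hp, h1, h2, h3⟩

/-- **`f(univ;∅) = Σ_{lab S = 0} cubeSlack Sᶜ − #rainbows`.** [this work] -/
theorem minorSlack_univ_empty :
    F.minorSlack univ ∅ = (∑ S ∈ (univ : Finset (Finset α)).filter (fun S => F.lab S = 0), F.cubeSlack Sᶜ) - (F.rainbowCard : ℤ) := by
  unfold minorSlack cubeSlack
  rw [F.minorRainbows_univ_empty, powerset_univ]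
  congr 1
  refine sum_congr (by ext S; simp only [mem_filter, union_empty]) fun S _ => ?_
  rw [← Finset.compl_eq_univ_sdiff, F.minorAB_empty, F.minorCR_empty]

end Sunflower

/-- **(DC) ⇒ (★_B).** [this work] -/
theorem bottomSlackPaysRainbows_of_minorSuperadditivity (h : MinorSuperadditivity) : BottomSlackPaysRainbows := by
  intro α _ _ F
  have h0 := F.minorSlack_nonneg_of_minorSuperadditivity h univ ∅ (Finset.disjoint_empty_right _)
  rw [F.minorSlack_univ_empty] at h0
  linarith

/-- **(DC) ⇒ ★** (`PartitionLemmaH`): deletion–contraction superadditivity of the bottom slack implies the partition lemma, hence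
`H_{q+t}`, `γ`, `G₄` and `AG⁺` for every product measure (prove-1's cloning reduction). [this work] -/
theorem partitionLemmaH_of_minorSuperadditivity (h : MinorSuperadditivity) : PartitionLemmaH :=
  partitionLemmaH_of_bottomSlackPaysRainbows (bottomSlackPaysRainbows_of_minorSuperadditivity h)

end Summit.CriticalPhenomena.PercolationContinuityZ3.Theorems.SunflowerPartition
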